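import Summits.QuantumFields.BalabanUV.T4Continuum.Support.NE9PolydiscStepOffCentre
import Summits.QuantumFields.BalabanUV.T4Continuum.Support.NE9StateLinftyEquiv

/-!
# NE9PolydiscChainOffCentre — ROUTE R4♯-T «TRANSLATION-AWARE SP CHAIN», PIECE (T-a), PART 2∕2: the polydisc Schwarz–Pick chain
# with OFF-CENTRE images on any `𝔛 ≃ₗᵢ[ℂ] ℓ^∞(A;ℂ)`, **`chainLipschitz_of_holoMaps_offCentre`**, and the END
# `NE9 ∧ FadingMemory` at constants `(1∕(1−θ²), μ)`
# (the OWNER t4-ne9-p1 generation 61's INTERFACE REQUEST NE9 «`NE9PolydiscChainOffCentre.chainLipschitz_of_holoMaps_offCentre`»,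
# cell journal l.29955 ∕ INBOX l.6154, on the crux refuter's PRICING-NE9 v10 §E (F-v10-4 ∕ Q-v10-1 «no obstruction»); cell
# `pub-balaban`, T4-DAG §2 node U3 ∕ §6 NE9; unit `b2b-balaban-t4-ne9-formalise-leaf-03`, generation 44; Summits-side NEW
# work on the tree's R4 interface `ChainLipschitz` ∕ `HoloSelfMaps` ∕ `ne9_and_fadingMemory_of_chainLipschitz` (p252549) and
# the R4♯ kernel `NE9PolydiscSchwarzPick` ∕ `NE9PolydiscChain` ∕ `NE9StateLinftyEquiv` (p255292 ∕ p255595 ∕ p255793);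
# nothing of any import modified, nothing printed asserted, no named fact, 0 `def`)

HONEST FRAMING (T4-DAG PAGE 1).  Rung (B)+1 of the FINITE-VOLUME T⁴ programme — NOT infinite volume, NOT a mass gap, NOT
the Clay problem.  NE9 (`T4OutputRate.NE9` ∧ `FadingMemory`) is a cell NEW ESTIMATE, NOT PRINTED in [I] = CMP **109**, [II] =
CMP **116**, and NOT PROVED here or anywhere: exactly as the tree's `NE9EarleHamiltonChain` ∕ `NE9PolydiscChain`, the ENDs
below conclude `NE9 ∧ FadingMemory` FROM DISPLAYED BINDERS («NE9 ⇐ the named binders»; spine PROVED 0∕9); the off-centre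
mapping property of the history step (piece (T-b), another seat's) and the record clause (T-c) (the owner lineage's) are
asserted of nothing.  A sharper RATE inside a conditional END is NOT progress on the estimate.  HONEST DEPENDENCY (cell line,
verbatim): continuum YM on T⁴ ⇐ BetaPertH ∧ nine spine estimates (0/9 proved); BetaPertH ⇐ (D1) ∧ (D4) ∧ CAP+tail; G-an2-4
gates asym, D1 and NE2/3/4.  Nothing of Bałaban's is constructed here; no letter of [I]∕[II] is asserted.

WHAT (all kernel-checked, 0 sorry; PART 1 = `NE9PolydiscStepOffCentre`: the sharp-radius Schwarz–Pick lemma, the one-step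
off-centre lemma, the unit-ball chain).
* §4–§5 the chain `norm_sub_le_of_holoChain_offCentre_linfty ∕ _polydisc` (radius `r` by dilation, then any
  `𝔛 ≃ₗᵢ[ℂ] ℓ^∞(A;ℂ)`): composites of holomorphic maps `B(0,r) → B̄(c_n, r₄)` with `‖c_n‖ ≤ c̄`, `c̄ + r₄ ≤ θr`, `θ < 1`, and a
  rate `μ` ADMISSIBLE for `(r, c̄, r₄)` — `(r₄² − ρ²)·r ≤ μ·r₄·(r² − (c̄ + ρ)²)` for all `ρ ∈ [0, r₄]` — are
  `(1∕(1−θ²))·μⁿ`-Lipschitz on `B̄(0,θr)`.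
* §6 route R4♯-T = the tree's REGISTERED shapes: **`chainLipschitz_of_holoMaps_offCentre : … → ChainLipschitz S W r θ
  (1∕(1−θ²)) μ`** (centres `c k g` may depend on the step AND the history — within one chain the history is fixed;
  `HoloSelfMaps` is implied, `holoSelfMaps_of_holoMaps_offCentre`), and the ENDs **`ne9_and_fadingMemory_of_holoMaps_offCentre`**
  ∕ **`…_state`** = `NE9PolydiscChain.ne9_and_fadingMemory_of_holoSelfMaps_polydisc` ∕ `NE9StateLinftyEquiv.…_state` with
  `hS : HoloSelfMaps S W r θ` REPLACED by the off-centre data `(c, hr₄, hcbar, hθ, hμ, hSd, hSm, hc)` and `hθ0` dropped, every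
  other binder VERBATIM: `NE9 E W κ (prodModuli (cR·(1∕(1−θ²))·ℓ) (fun _ ↦ μ)) ∧ FadingMemory (cR·(1∕(1−θ²))·ℓ∕μ) μ (…)`.
* §6♭ THE ∃-FORM DOCKING FACE `chainLipschitz_of_offCentreMaps_polydisc` (the planner `t4-ne9-idea-1` generation 9's shape,
  scratch `t4/ideate/NE9/lens1-NE9OffCentreChain.lean` 409b85d4eb69d683 §5: «image in SOME `B̄(c, r₄)`, `‖c‖ ≤ c̄`» — one
  `choose` from the function form), with a kernel-checked junction `example`: the planner's §5 binder list (quadratic test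
  at `(c̄, t′, λ)`, `0 < t < t′`, `θ = c̄ + t`) ⇒ `ChainLipschitz S W r θ (1∕(1−θ²)) λ` through PART 1's `rateIneq_of_quadTest`;
  and the centred case `c k g = 0`, `μ = θ` = `NE9PolydiscChain.chainLipschitz_of_holoSelfMaps_polydisc` (kernel-checked
  `example`, PART 1's `rateIneq_centred`).
* §T sanity arithmetic (pure numbers; the refuter's table-H letters, a READING of [II] p. 21 — NOT certified, asserted
  nowhere): at `r = 1`, `θ = 15∕26`, `c̄ = 1∕4`, `r₄ = 17∕52` the rate `μ = 44∕125 = 0.352` is admissible (v10's grid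
  supremum `0.3518`), versus the centred rate `15∕26 ≈ 0.577`.
USE.  The END of record re-threads through the chain-generic `NE9FutureProfileEndOfRecordSP.…_injRead_of_chain` with
`hchain := chainLipschitz_of_holoMaps_offCentre (stateLinftyEquiv …) …`, `hkk := rate_pos …` (owner lineage, piece (T-c));
the off-centre `MapsTo` of the step map is piece (T-b).  Neither is filed here.
DISGUISE TEST: no inequality of the series; not NE9 for Bałaban's terms; no Bałaban object; 0 sorry; no named fact; nothing
printed asserted.  What route R4∕R4♯∕R4♯-T still needs is UNCHANGED by this file: the instance at the class of record, W1 =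
(D1), (R-1a), the room N2 read as a slack inequality.

References: [FV1980] T. Franzoni, E. Vesentini, North-Holland Math. Studies 40 (1980), ch. IV–V; [Harris1979] L. A. Harris,
North-Holland Math. Studies 34 (1979) 345–406; [EH1970] C. J. Earle, R. S. Hamilton, Proc. Sympos. Pure Math. XVI (1970)
61–65; [Balaban1988RG2Cluster] T. Bałaban, CMP **116** (1988) 1–22, pp. 8, 20 (2.38), 21 (TYPES ∕ loci only; nothing
asserted).
-/

noncomputable section

namespace Summit.QuantumFields.BalabanUV.T4Continuum.NE9PolydiscChainOffCentre

open Metric Set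
open scoped ENNReal
open Summit.QuantumFields.BalabanUV.T4Continuum.NE9EarleHamiltonChain (evol evol_of_le evol_succ_apply HoloSelfMaps
  ChainLipschitz ne9_and_fadingMemory_of_chainLipschitz)
open Summit.QuantumFields.BalabanUV.T4Continuum.NE9PolydiscStepOffCentre (rate_pos rateIneq_centred rateIneq_of_quadTest
  mapsTo_closedBall_zero_of_offCentre norm_sub_le_of_holoChain_offCentre_unit)
open Summit.QuantumFields.BalabanUV.T4Continuum.NE9StateLinftyEquiv (stateLinftyEquiv)
open Literature.MathematicalPhysics.QuantumFieldTheory.Balaban1983to89.T4OutputRate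
open Literature.MathematicalPhysics.QuantumFieldTheory.Balaban1983to89.T4HistoryLipschitzRecursion (prodModuli)

variable {A : Type*}

/-! ## §4 The chain estimate on `ℓ^∞(A;ℂ)`, ball of radius `r` (dilation) -/

/-- THE CHAIN on `ℓ^∞(A;ℂ)`, ball of radius `r`, OFF-CENTRE IMAGES: holomorphic maps `B(0,r) → B̄(c_n, r₄)` with
`‖c_n‖ ≤ c̄`, `c̄ + r₄ ≤ θr`, `θ < 1`, and a rate `μ` admissible for `(r, c̄, r₄)` —
`(r₄² − ρ²)·r ≤ μ·r₄·(r² − (c̄ + ρ)²)` on `[0, r₄]` — compose to `(1/(1−θ²))·μⁿ`-Lipschitz maps of `B̄(0,θr)`. [folklore] -/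
theorem norm_sub_le_of_holoChain_offCentre_linfty {r θ cbar r₄ μ : ℝ} (hr : 0 < r) (hr₄ : 0 < r₄)
    (hθ : cbar + r₄ ≤ θ * r) (hθ1 : θ < 1)
    (hμ : ∀ ρ ∈ Icc (0 : ℝ) r₄, (r₄ ^ 2 - ρ ^ 2) * r ≤ μ * r₄ * (r ^ 2 - (cbar + ρ) ^ 2))
    {f : ℕ → lp (fun _ : A => ℂ) ∞ → lp (fun _ : A => ℂ) ∞}
    (hfd : ∀ n, DifferentiableOn ℂ (f n) (ball (0 : lp (fun _ : A => ℂ) ∞) r))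
    {c : ℕ → lp (fun _ : A => ℂ) ∞}
    (hfm : ∀ n, MapsTo (f n) (ball (0 : lp (fun _ : A => ℂ) ∞) r) (closedBall (c n) r₄))
    (hc : ∀ n, ‖c n‖ ≤ cbar)
    {T : ℕ → lp (fun _ : A => ℂ) ∞ → lp (fun _ : A => ℂ) ∞} (hT0 : T 0 = id)
    (hT : ∀ n, T (n + 1) = f n ∘ T n) (n : ℕ) {x y : lp (fun _ : A => ℂ) ∞}
    (hx : x ∈ closedBall (0 : lp (fun _ : A => ℂ) ∞) (θ * r))
    (hy : y ∈ closedBall (0 : lp (fun _ : A => ℂ) ∞) (θ * r)) :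
    ‖T n x - T n y‖ ≤ 1 / (1 - θ ^ 2) * μ ^ n * ‖x - y‖ := by
  have hr0 : (r : ℂ) ≠ 0 := Complex.ofReal_ne_zero.2 hr.ne'
  have hnr : ∀ z : lp (fun _ : A => ℂ) ∞, ‖(r : ℂ) • z‖ = r * ‖z‖ := fun z => by
    rw [norm_smul, Complex.norm_of_nonneg hr.le]
  have hnr' : ∀ z : lp (fun _ : A => ℂ) ∞, ‖(r : ℂ)⁻¹ • z‖ = r⁻¹ * ‖z‖ := fun z => by
    rw [norm_smul, norm_inv, Complex.norm_of_nonneg hr.le]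
  -- the conjugated chain on the unit ball, with scaled centres
  set g : ℕ → lp (fun _ : A => ℂ) ∞ → lp (fun _ : A => ℂ) ∞ :=
    fun n z => (r : ℂ)⁻¹ • f n ((r : ℂ) • z) with hg
  set U : ℕ → lp (fun _ : A => ℂ) ∞ → lp (fun _ : A => ℂ) ∞ :=
    fun n z => (r : ℂ)⁻¹ • T n ((r : ℂ) • z) with hU
  set c' : ℕ → lp (fun _ : A => ℂ) ∞ := fun n => (r : ℂ)⁻¹ • c n with hc'
  have hU0 : U 0 = id := by
    funext z
    show (r : ℂ)⁻¹ • T 0 ((r : ℂ) • z) = z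
    rw [hT0]
    show (r : ℂ)⁻¹ • ((r : ℂ) • z) = z
    rw [smul_smul, inv_mul_cancel₀ hr0, one_smul]
  have hUs : ∀ n, U (n + 1) = g n ∘ U n := by
    intro n; funext z
    show (r : ℂ)⁻¹ • T (n + 1) ((r : ℂ) • z) =
      (r : ℂ)⁻¹ • f n ((r : ℂ) • ((r : ℂ)⁻¹ • T n ((r : ℂ) • z)))
    rw [hT n, Function.comp_apply, smul_smul, mul_inv_cancel₀ hr0, one_smul]
  have hball : MapsTo (fun z : lp (fun _ : A => ℂ) ∞ => (r : ℂ) • z) (ball 0 1) (ball 0 r) := by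
    intro z hz
    rw [mem_ball_zero_iff] at hz ⊢
    rw [hnr]; nlinarith
  have hgd : ∀ n, DifferentiableOn ℂ (g n) (ball (0 : lp (fun _ : A => ℂ) ∞) 1) := fun n =>
    ((hfd n).comp ((differentiable_id.const_smul (r : ℂ)).differentiableOn) hball).const_smul ((r : ℂ)⁻¹)
  have hgm : ∀ n, MapsTo (g n) (ball (0 : lp (fun _ : A => ℂ) ∞) 1) (closedBall (c' n) (r₄ / r)) := by
    intro n z hz
    have h := hfm n (hball hz)
    rw [mem_closedBall, dist_eq_norm] at h ⊢
    show ‖(r : ℂ)⁻¹ • f n ((r : ℂ) • z) - (r : ℂ)⁻¹ • c n‖ ≤ r₄ / r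
    rw [← smul_sub, hnr', div_eq_inv_mul]
    exact mul_le_mul_of_nonneg_left h (inv_nonneg.2 hr.le)
  have hcn : ∀ n, ‖c' n‖ ≤ cbar / r := fun n => by
    show ‖(r : ℂ)⁻¹ • c n‖ ≤ cbar / r
    rw [hnr', div_eq_inv_mul]
    exact mul_le_mul_of_nonneg_left (hc n) (inv_nonneg.2 hr.le)
  have hθ' : cbar / r + r₄ / r ≤ θ := by
    rw [← add_div, div_le_iff₀ hr]; exact hθ
  have hρ₄ : 0 < r₄ / r := div_pos hr₄ hr
  have hμ' : ∀ ρ ∈ Icc (0 : ℝ) (r₄ / r), (r₄ / r) ^ 2 - ρ ^ 2 ≤ μ * (r₄ / r) * (1 - (cbar / r + ρ) ^ 2) := by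
    intro ρ hρ
    have hρ' : r * ρ ∈ Icc (0 : ℝ) r₄ := by
      refine ⟨mul_nonneg hr.le hρ.1, ?_⟩
      calc r * ρ ≤ r * (r₄ / r) := mul_le_mul_of_nonneg_left hρ.2 hr.le
        _ = r₄ := by field_simp
    have h := hμ (r * ρ) hρ'
    have key : r ^ 3 * ((r₄ / r) ^ 2 - ρ ^ 2) ≤ r ^ 3 * (μ * (r₄ / r) * (1 - (cbar / r + ρ) ^ 2)) := by
      calc r ^ 3 * ((r₄ / r) ^ 2 - ρ ^ 2) = (r₄ ^ 2 - (r * ρ) ^ 2) * r := by field_simp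
        _ ≤ μ * r₄ * (r ^ 2 - (cbar + r * ρ) ^ 2) := h
        _ = r ^ 3 * (μ * (r₄ / r) * (1 - (cbar / r + ρ) ^ 2)) := by field_simp
    exact le_of_mul_le_mul_left key (pow_pos hr 3)
  have hin : ∀ z ∈ closedBall (0 : lp (fun _ : A => ℂ) ∞) (θ * r),
      (r : ℂ)⁻¹ • z ∈ closedBall (0 : lp (fun _ : A => ℂ) ∞) θ := by
    intro z hz
    rw [mem_closedBall_zero_iff] at hz ⊢
    rw [hnr']
    calc r⁻¹ * ‖z‖ ≤ r⁻¹ * (θ * r) := mul_le_mul_of_nonneg_left hz (inv_nonneg.2 hr.le)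
      _ = θ := by field_simp
  have key := norm_sub_le_of_holoChain_offCentre_unit hρ₄ hθ' hθ1 hμ' hgd hgm hcn hU0 hUs n (hin x hx) (hin y hy)
  have h1 : U n ((r : ℂ)⁻¹ • x) - U n ((r : ℂ)⁻¹ • y) = (r : ℂ)⁻¹ • (T n x - T n y) := by
    show (r : ℂ)⁻¹ • T n ((r : ℂ) • ((r : ℂ)⁻¹ • x)) - (r : ℂ)⁻¹ • T n ((r : ℂ) • ((r : ℂ)⁻¹ • y)) = _
    rw [smul_smul, smul_smul, mul_inv_cancel₀ hr0, one_smul, one_smul, smul_sub]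
  have h2 : (r : ℂ)⁻¹ • x - (r : ℂ)⁻¹ • y = (r : ℂ)⁻¹ • (x - y) := (smul_sub _ _ _).symm
  rw [h1, h2, hnr', hnr'] at key
  have key' : r⁻¹ * ‖T n x - T n y‖ ≤ r⁻¹ * (1 / (1 - θ ^ 2) * μ ^ n * ‖x - y‖) := by
    calc r⁻¹ * ‖T n x - T n y‖ ≤ 1 / (1 - θ ^ 2) * μ ^ n * (r⁻¹ * ‖x - y‖) := key
      _ = r⁻¹ * (1 / (1 - θ ^ 2) * μ ^ n * ‖x - y‖) := by ring
  exact le_of_mul_le_mul_left key' (inv_pos.2 hr)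

/-! ## §5 Any complex Banach space isometric to `ℓ^∞(A;ℂ)` -/

/-- **THE OFF-CENTRE POLYDISC CHAIN ESTIMATE** (route R4♯-T's kernel): in any complex Banach space ISOMETRIC TO `ℓ^∞(A;ℂ)`,
holomorphic maps `B(0,r) → B̄(c_n, r₄)` with `‖c_n‖ ≤ c̄`, `c̄ + r₄ ≤ θr`, `θ < 1`, and an admissible rate `μ`, compose to
`(1/(1−θ²))·μⁿ`-Lipschitz maps of the inner ball `B̄(0,θr)` — compare `NE9PolydiscChain.norm_sub_le_of_holoChain_polydisc`
(centred images `B̄(0,θr)`, rate `θ`). [folklore; FV1980; Harris1979] -/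
theorem norm_sub_le_of_holoChain_offCentre_polydisc {𝔛 : Type*} [NormedAddCommGroup 𝔛] [NormedSpace ℂ 𝔛]
    (e : 𝔛 ≃ₗᵢ[ℂ] lp (fun _ : A => ℂ) ∞) {r θ cbar r₄ μ : ℝ} (hr : 0 < r) (hr₄ : 0 < r₄)
    (hθ : cbar + r₄ ≤ θ * r) (hθ1 : θ < 1)
    (hμ : ∀ ρ ∈ Icc (0 : ℝ) r₄, (r₄ ^ 2 - ρ ^ 2) * r ≤ μ * r₄ * (r ^ 2 - (cbar + ρ) ^ 2))
    {f : ℕ → 𝔛 → 𝔛} (hfd : ∀ n, DifferentiableOn ℂ (f n) (ball (0 : 𝔛) r)) {c : ℕ → 𝔛}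
    (hfm : ∀ n, MapsTo (f n) (ball (0 : 𝔛) r) (closedBall (c n) r₄)) (hc : ∀ n, ‖c n‖ ≤ cbar)
    {T : ℕ → 𝔛 → 𝔛} (hT0 : T 0 = id) (hT : ∀ n, T (n + 1) = f n ∘ T n) (n : ℕ)
    {x y : 𝔛} (hx : x ∈ closedBall (0 : 𝔛) (θ * r)) (hy : y ∈ closedBall (0 : 𝔛) (θ * r)) :
    ‖T n x - T n y‖ ≤ 1 / (1 - θ ^ 2) * μ ^ n * ‖x - y‖ := by
  set g : ℕ → lp (fun _ : A => ℂ) ∞ → lp (fun _ : A => ℂ) ∞ := fun n z => e (f n (e.symm z)) with hg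
  set U : ℕ → lp (fun _ : A => ℂ) ∞ → lp (fun _ : A => ℂ) ∞ := fun n z => e (T n (e.symm z)) with hU
  have hU0 : U 0 = id := by funext z; simp [hU, hT0]
  have hUs : ∀ n, U (n + 1) = g n ∘ U n := by intro n; funext z; simp [hU, hg, hT n]
  have hball : MapsTo e.symm (ball (0 : lp (fun _ : A => ℂ) ∞) r) (ball (0 : 𝔛) r) := fun z hz => by
    rw [mem_ball_zero_iff] at hz ⊢
    rwa [e.symm.norm_map]
  have hgd : ∀ n, DifferentiableOn ℂ (g n) (ball (0 : lp (fun _ : A => ℂ) ∞) r) := fun n =>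
    e.differentiable.comp_differentiableOn ((hfd n).comp e.symm.differentiable.differentiableOn hball)
  have hgm : ∀ n, MapsTo (g n) (ball (0 : lp (fun _ : A => ℂ) ∞) r) (closedBall (e (c n)) r₄) := by
    intro n z hz
    have h := hfm n (hball hz)
    rw [mem_closedBall, dist_eq_norm] at h ⊢
    show ‖e (f n (e.symm z)) - e (c n)‖ ≤ r₄
    rwa [← map_sub, e.norm_map]
  have hcn : ∀ n, ‖e (c n)‖ ≤ cbar := fun n => by rw [e.norm_map]; exact hc n
  have hin : ∀ z ∈ closedBall (0 : 𝔛) (θ * r), e z ∈ closedBall (0 : lp (fun _ : A => ℂ) ∞) (θ * r) := by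
    intro z hz
    rw [mem_closedBall_zero_iff] at hz ⊢
    rwa [e.norm_map]
  have key := norm_sub_le_of_holoChain_offCentre_linfty hr hr₄ hθ hθ1 hμ hgd hgm hcn hU0 hUs n (hin x hx) (hin y hy)
  have h1 : U n (e x) - U n (e y) = e (T n x - T n y) := by simp [hU]
  have h2 : e x - e y = e (x - y) := (map_sub e x y).symm
  rwa [h1, h2, e.norm_map, e.norm_map] at key

/-! ## §6 Route R4♯-T: the tree's registered shapes at the constants `(1/(1−θ²), μ)` -/

/-- The CENTRED CONSEQUENCE of the off-centre hypotheses: `B̄(c k g, r₄) ⊆ B̄(0, θr)`, so the tree's `HoloSelfMaps S W r θ`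
holds (what `Factorises` ∕ the read-out of the R4 ENDs consume). [folklore] -/
theorem holoSelfMaps_of_holoMaps_offCentre {𝔛 : Type*} [NormedAddCommGroup 𝔛] [NormedSpace ℂ 𝔛]
    {S : ℕ → (ℕ → ℝ) → 𝔛 → 𝔛} {W : Set (ℕ → ℝ)} (c : ℕ → (ℕ → ℝ) → 𝔛) {r θ cbar r₄ : ℝ}
    (hθ : cbar + r₄ ≤ θ * r)
    (hSd : ∀ k, ∀ g ∈ W, DifferentiableOn ℂ (S k g) (ball (0 : 𝔛) r))
    (hSm : ∀ k, ∀ g ∈ W, MapsTo (S k g) (ball (0 : 𝔛) r) (closedBall (c k g) r₄))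
    (hc : ∀ k, ∀ g ∈ W, ‖c k g‖ ≤ cbar) : HoloSelfMaps S W r θ :=
  fun k g hg => ⟨hSd k g hg, mapsTo_closedBall_zero_of_offCentre (hSm k g hg) (hc k g hg) hθ⟩

/-- **ROUTE R4♯-T KERNEL — the OWNER's INTERFACE REQUEST NE9 (T-a).**  Holomorphic step maps `S k g : B(0,r) → B̄(c k g, r₄)`
of a complex Banach space ISOMETRIC TO `ℓ^∞(A;ℂ)` (`e`), uniformly in the step `k` and the history `g ∈ W`, with centres
`‖c k g‖ ≤ c̄` (step- AND history-dependent centres allowed: within one chain the history is fixed), `0 < r₄`,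
`c̄ + r₄ ≤ θr`, `θ < 1`, and a rate `μ` admissible for `(r, c̄, r₄)`: the tree's `ChainLipschitz S W r θ (1/(1−θ²)) μ`.
Compare `NE9PolydiscChain.chainLipschitz_of_holoSelfMaps_polydisc` (centred images, rate `θ`; recovered in §7).  `0 < θ` and
`0 < μ` are consequences (`rate_pos`). [folklore; FV1980; Harris1979] -/
theorem chainLipschitz_of_holoMaps_offCentre {𝔛 : Type*} [NormedAddCommGroup 𝔛] [NormedSpace ℂ 𝔛]
    (e : 𝔛 ≃ₗᵢ[ℂ] lp (fun _ : A => ℂ) ∞) {S : ℕ → (ℕ → ℝ) → 𝔛 → 𝔛} {W : Set (ℕ → ℝ)}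
    (c : ℕ → (ℕ → ℝ) → 𝔛) {r θ cbar r₄ μ : ℝ} (hr : 0 < r) (hr₄ : 0 < r₄) (hθ : cbar + r₄ ≤ θ * r)
    (hθ1 : θ < 1) (hμ : ∀ ρ ∈ Icc (0 : ℝ) r₄, (r₄ ^ 2 - ρ ^ 2) * r ≤ μ * r₄ * (r ^ 2 - (cbar + ρ) ^ 2))
    (hSd : ∀ k, ∀ g ∈ W, DifferentiableOn ℂ (S k g) (ball (0 : 𝔛) r))
    (hSm : ∀ k, ∀ g ∈ W, MapsTo (S k g) (ball (0 : 𝔛) r) (closedBall (c k g) r₄))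
    (hc : ∀ k, ∀ g ∈ W, ‖c k g‖ ≤ cbar) :
    ChainLipschitz S W r θ (1 / (1 - θ ^ 2)) μ := by
  intro g hg i K x hx y hy
  have hcbar : 0 ≤ cbar := (norm_nonneg (c 0 g)).trans (hc 0 g hg)
  have hθ0 : 0 < θ := by
    have h1 : 0 < θ * r := lt_of_lt_of_le (by linarith) hθ
    exact pos_of_mul_pos_left h1 hr.le
  rcases le_or_gt K i with hKi | hiK
  · rw [evol_of_le hKi, Nat.sub_eq_zero_of_le hKi, pow_zero, mul_one, id, id]
    have h1θ : 0 < 1 - θ ^ 2 := by nlinarith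
    have h1 : (1 : ℝ) ≤ 1 / (1 - θ ^ 2) := by
      rw [le_div_iff₀ h1θ]; nlinarith
    nlinarith [norm_nonneg (x - y)]
  · obtain ⟨n, rfl⟩ := Nat.exists_eq_add_of_lt hiK
    have key := norm_sub_le_of_holoChain_offCentre_polydisc e hr hr₄ hθ hθ1 hμ (f := fun m => S (i + m) g)
      (c := fun m => c (i + m) g) (T := fun m => evol (fun j => S j g) i (i + m))
      (fun m => hSd (i + m) g hg) (fun m => hSm (i + m) g hg) (fun m => hc (i + m) g hg)
      (evol_of_le le_rfl) (fun m => funext fun z => evol_succ_apply (Nat.le_add_right i m) z) (n + 1) hx hy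
    have hsub : i + n + 1 - i = n + 1 := by omega
    rw [hsub]
    exact key

/-- **THE ∃-FORM DOCKING FACE** — the planner `t4-ne9-idea-1` generation 9's shape `chainLipschitz_of_offCentreMaps_polydisc`
(scratch `t4/ideate/NE9/lens1-NE9OffCentreChain.lean` sha16 409b85d4eb69d683 §5) at this file's rate inequality: each step map
need only lie in SOME off-centre ball `B̄(c, r₄)` with `‖c‖ ≤ c̄` (one `choose` from the function form; centres off `W` are
irrelevant).  With PART 1's `rateIneq_of_quadTest` this is the planner's §5 at `(c̄, r₄) = (cb·r, t·r)` — junction `example`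
below. [folklore] -/
theorem chainLipschitz_of_offCentreMaps_polydisc {𝔛 : Type*} [NormedAddCommGroup 𝔛] [NormedSpace ℂ 𝔛]
    (e : 𝔛 ≃ₗᵢ[ℂ] lp (fun _ : A => ℂ) ∞) {S : ℕ → (ℕ → ℝ) → 𝔛 → 𝔛} {W : Set (ℕ → ℝ)}
    {r θ cbar r₄ μ : ℝ} (hr : 0 < r) (hr₄ : 0 < r₄) (hθ : cbar + r₄ ≤ θ * r) (hθ1 : θ < 1)
    (hμ : ∀ ρ ∈ Icc (0 : ℝ) r₄, (r₄ ^ 2 - ρ ^ 2) * r ≤ μ * r₄ * (r ^ 2 - (cbar + ρ) ^ 2))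
    (hS : ∀ k, ∀ g ∈ W, DifferentiableOn ℂ (S k g) (ball (0 : 𝔛) r) ∧
      ∃ c : 𝔛, ‖c‖ ≤ cbar ∧ MapsTo (S k g) (ball (0 : 𝔛) r) (closedBall c r₄)) :
    ChainLipschitz S W r θ (1 / (1 - θ ^ 2)) μ := by
  classical
  have hex : ∀ k (g : ℕ → ℝ), ∃ c : 𝔛, g ∈ W → ‖c‖ ≤ cbar ∧ MapsTo (S k g) (ball (0 : 𝔛) r) (closedBall c r₄) := by
    intro k g
    by_cases hg : g ∈ W
    · obtain ⟨c, h1, h2⟩ := (hS k g hg).2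
      exact ⟨c, fun _ => ⟨h1, h2⟩⟩
    · exact ⟨0, fun h => absurd h hg⟩
  choose c hc using hex
  exact chainLipschitz_of_holoMaps_offCentre e c hr hr₄ hθ hθ1 hμ (fun k g hg => (hS k g hg).1)
    (fun k g hg => (hc k g hg).2) (fun k g hg => (hc k g hg).1)

/-- JUNCTION (kernel-checked): the planner's §5 binder list — quadratic test at `(c̄, t′, λ)`, `0 < t < t′`, `c̄ + t′ ≤ 1`,
`λt′ < 1`, `θ = c̄ + t`, images in SOME `B̄(c, t·r)` with `‖c‖ ≤ c̄·r` — gives `ChainLipschitz S W r θ (1∕(1−θ²)) λ` through the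
∃-form face and PART 1's `rateIneq_of_quadTest` (the planner allows `t = 0`; here `0 < t`). -/
example {𝔛 : Type*} [NormedAddCommGroup 𝔛] [NormedSpace ℂ 𝔛] (e : 𝔛 ≃ₗᵢ[ℂ] lp (fun _ : A => ℂ) ∞)
    {S : ℕ → (ℕ → ℝ) → 𝔛 → 𝔛} {W : Set (ℕ → ℝ)} {r t t' cb lam θ : ℝ} (hr : 0 < r) (ht0 : 0 < t) (htt' : t < t')
    (hcb1 : cb + t' ≤ 1) (hlt : lam * t' < 1)
    (hquad : (lam * t' * cb) ^ 2 ≤ (lam * t' * (1 - cb ^ 2) - t' ^ 2) * (1 - lam * t')) (hθ : cb + t = θ)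
    (hS : ∀ k, ∀ g ∈ W, DifferentiableOn ℂ (S k g) (ball (0 : 𝔛) r) ∧
      ∃ c : 𝔛, ‖c‖ ≤ cb * r ∧ MapsTo (S k g) (ball (0 : 𝔛) r) (closedBall c (t * r))) :
    ChainLipschitz S W r θ (1 / (1 - θ ^ 2)) lam :=
  chainLipschitz_of_offCentreMaps_polydisc e hr (mul_pos ht0 hr) (by rw [← hθ, add_mul]) (by linarith)
    (rateIneq_of_quadTest hr ht0 htt'.le hlt hquad) hS

/-- **ROUTE R4♯-T END** — `NE9PolydiscChain`'s END `ne9_and_fadingMemory_of_holoSelfMaps_polydisc` with `hS : HoloSelfMaps S W r θ`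
REPLACED by the off-centre data `(c, hr₄, hcbar, hθ, hμ, hSd, hSm, hc)` (and `hθ0` dropped — a consequence), every other
binder VERBATIM (same order): `NE9 E W κ (prodModuli (cR·(1/(1−θ²))·ℓ) (fun _ ↦ μ)) ∧ FadingMemory (cR·(1/(1−θ²))·ℓ/μ) μ
(…)` — rate `μ` instead of `θ`.  HONEST: concludes `NE9 ∧ FadingMemory` FROM DISPLAYED BINDERS (the off-centre mapping
property = the instance's burden, pieces (T-b)(T-c) of other seats, asserted of nothing); NE9 NOT PRINTED, NOT PROVED;
spine 0∕9. [folklore] -/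
theorem ne9_and_fadingMemory_of_holoMaps_offCentre {𝔛 : Type*} [NormedAddCommGroup 𝔛] [NormedSpace ℂ 𝔛]
    (e : 𝔛 ≃ₗᵢ[ℂ] lp (fun _ : A => ℂ) ∞)
    {C : Carriers} {Bg : Type} (E : Functional C Bg) (W : Set (ℕ → ℝ))
    (S : ℕ → (ℕ → ℝ) → 𝔛 → 𝔛) (emb : ℕ → (ℕ → ℝ) → 𝔛) {κ r θ ℓ cR : ℝ} {lam : ℕ → ℝ}
    (c : ℕ → (ℕ → ℝ) → 𝔛) {cbar r₄ μ : ℝ}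
    (hr : 0 < r) (hθ1 : θ < 1) (hℓ : 0 ≤ ℓ) (hcR : 0 ≤ cR)
    (hr₄ : 0 < r₄) (hcbar : 0 ≤ cbar) (hθ : cbar + r₄ ≤ θ * r)
    (hμ : ∀ ρ ∈ Icc (0 : ℝ) r₄, (r₄ ^ 2 - ρ ^ 2) * r ≤ μ * r₄ * (r ^ 2 - (cbar + ρ) ^ 2))
    (hSd : ∀ k, ∀ g ∈ W, DifferentiableOn ℂ (S k g) (ball (0 : 𝔛) r))
    (hSm : ∀ k, ∀ g ∈ W, MapsTo (S k g) (ball (0 : 𝔛) r) (closedBall (c k g) r₄))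
    (hc : ∀ k, ∀ g ∈ W, ‖c k g‖ ≤ cbar)
    (hfac : ∀ j, ∀ g ∈ W, emb (j + 1) g = S j g (emb j g))
    (h0 : ∀ g ∈ W, ∀ g' ∈ W, emb 0 g = emb 0 g')
    (h0in : ∀ g ∈ W, emb 0 g ∈ closedBall (0 : 𝔛) (θ * r))
    (hlast : ∀ j, ∀ g ∈ W, ∀ g' ∈ W, ‖S j g (emb j g) - S j g' (emb j g)‖ ≤ lam j * |g j - g' j|)
    (hlam : ∀ j, lam j ≤ ℓ)
    (hread : ∀ g ∈ W, ∀ g' ∈ W, ∀ (U : Bg) (X : C.Dom),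
      |E g U X - E g' U X| ≤ Real.exp (-(κ * C.d X)) * (cR * ‖emb (C.scale X) g - emb (C.scale X) g'‖)) :
    NE9 E W κ (prodModuli (cR * (1 / (1 - θ ^ 2)) * ℓ) fun _ => μ) ∧
      FadingMemory (cR * (1 / (1 - θ ^ 2)) * ℓ / μ) μ (prodModuli (cR * (1 / (1 - θ ^ 2)) * ℓ) fun _ => μ) := by
  have hμ0 : 0 < μ := rate_pos hr hcbar hr₄ (lt_of_le_of_lt hθ (by nlinarith)) hμ
  have hθ0 : 0 < θ := pos_of_mul_pos_left (lt_of_lt_of_le (by linarith) hθ) hr.le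
  exact ne9_and_fadingMemory_of_chainLipschitz E W S emb hr hθ1 (one_div_nonneg.2 (by nlinarith)) hμ0 hℓ hcR
    (fun j g hg => (holoSelfMaps_of_holoMaps_offCentre c hθ hSd hSm hc j g hg).2)
    (chainLipschitz_of_holoMaps_offCentre e c hr hr₄ hθ hθ1 hμ hSd hSm hc) hfac h0 h0in hlast hlam hread

section DropIn

variable {B₁ : Type*} {I : Type*} [TopologicalSpace I] [DiscreteTopology I] {ι : Type*}

/-- **ROUTE R4♯-T END, DROP-IN FORM** on K2♭'s ambient state space `ℓ^∞(B₁;ℂ) × (I →ᵇ ℓ^∞(ι;ℂ))` (no `e` argument —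
`e := NE9StateLinftyEquiv.stateLinftyEquiv B₁ I ι`); binders = the previous END's.  HONEST: hypotheses → `NE9 ∧ FadingMemory`; NE9 NOT
PRINTED, NOT PROVED; spine 0∕9. [folklore] -/
theorem ne9_and_fadingMemory_of_holoMaps_offCentre_state
    {C : Carriers} {Bg : Type} (E : Functional C Bg) (W : Set (ℕ → ℝ))
    (S : ℕ → (ℕ → ℝ) → (lp (fun _ : B₁ => ℂ) ∞ × BoundedContinuousFunction I (lp (fun _ : ι => ℂ) ∞)) →
      (lp (fun _ : B₁ => ℂ) ∞ × BoundedContinuousFunction I (lp (fun _ : ι => ℂ) ∞)))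
    (emb : ℕ → (ℕ → ℝ) → (lp (fun _ : B₁ => ℂ) ∞ × BoundedContinuousFunction I (lp (fun _ : ι => ℂ) ∞)))
    {κ r θ ℓ cR : ℝ} {lam : ℕ → ℝ}
    (c : ℕ → (ℕ → ℝ) → (lp (fun _ : B₁ => ℂ) ∞ × BoundedContinuousFunction I (lp (fun _ : ι => ℂ) ∞)))
    {cbar r₄ μ : ℝ}
    (hr : 0 < r) (hθ1 : θ < 1) (hℓ : 0 ≤ ℓ) (hcR : 0 ≤ cR)
    (hr₄ : 0 < r₄) (hcbar : 0 ≤ cbar) (hθ : cbar + r₄ ≤ θ * r)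
    (hμ : ∀ ρ ∈ Icc (0 : ℝ) r₄, (r₄ ^ 2 - ρ ^ 2) * r ≤ μ * r₄ * (r ^ 2 - (cbar + ρ) ^ 2))
    (hSd : ∀ k, ∀ g ∈ W, DifferentiableOn ℂ (S k g)
      (ball (0 : lp (fun _ : B₁ => ℂ) ∞ × BoundedContinuousFunction I (lp (fun _ : ι => ℂ) ∞)) r))
    (hSm : ∀ k, ∀ g ∈ W, MapsTo (S k g)
      (ball (0 : lp (fun _ : B₁ => ℂ) ∞ × BoundedContinuousFunction I (lp (fun _ : ι => ℂ) ∞)) r)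
      (closedBall (c k g) r₄))
    (hc : ∀ k, ∀ g ∈ W, ‖c k g‖ ≤ cbar)
    (hfac : ∀ j, ∀ g ∈ W, emb (j + 1) g = S j g (emb j g))
    (h0 : ∀ g ∈ W, ∀ g' ∈ W, emb 0 g = emb 0 g')
    (h0in : ∀ g ∈ W, emb 0 g ∈ closedBall (0 : lp (fun _ : B₁ => ℂ) ∞ × BoundedContinuousFunction I (lp (fun _ : ι => ℂ) ∞))
      (θ * r))
    (hlast : ∀ j, ∀ g ∈ W, ∀ g' ∈ W, ‖S j g (emb j g) - S j g' (emb j g)‖ ≤ lam j * |g j - g' j|)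
    (hlam : ∀ j, lam j ≤ ℓ)
    (hread : ∀ g ∈ W, ∀ g' ∈ W, ∀ (U : Bg) (X : C.Dom),
      |E g U X - E g' U X| ≤ Real.exp (-(κ * C.d X)) * (cR * ‖emb (C.scale X) g - emb (C.scale X) g'‖)) :
    NE9 E W κ (prodModuli (cR * (1 / (1 - θ ^ 2)) * ℓ) fun _ => μ) ∧
      FadingMemory (cR * (1 / (1 - θ ^ 2)) * ℓ / μ) μ (prodModuli (cR * (1 / (1 - θ ^ 2)) * ℓ) fun _ => μ) :=
  ne9_and_fadingMemory_of_holoMaps_offCentre (stateLinftyEquiv B₁ I ι) E W S emb c hr hθ1 hℓ hcR hr₄ hcbar hθ hμ hSd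
    hSm hc hfac h0 h0in hlast hlam hread

end DropIn

/-! ## §6♮ The centred special case -/

/-- SANITY (the special case, kernel-checked): `NE9PolydiscChain`'s `ChainLipschitz S W r θ (1/(1−θ²)) θ` from `HoloSelfMaps S W r θ`
through `chainLipschitz_of_holoMaps_offCentre` with centres `0`, `r₄ = θr`, `c̄ = 0`, `μ = θ`. -/
example {𝔛 : Type*} [NormedAddCommGroup 𝔛] [NormedSpace ℂ 𝔛] (e : 𝔛 ≃ₗᵢ[ℂ] lp (fun _ : A => ℂ) ∞)
    {S : ℕ → (ℕ → ℝ) → 𝔛 → 𝔛} {W : Set (ℕ → ℝ)} {r θ : ℝ} (hr : 0 < r) (hθ0 : 0 < θ) (hθ1 : θ < 1)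
    (hS : HoloSelfMaps S W r θ) : ChainLipschitz S W r θ (1 / (1 - θ ^ 2)) θ :=
  chainLipschitz_of_holoMaps_offCentre e (fun _ _ => 0) (cbar := 0) hr (mul_pos hθ0 hr) (by rw [zero_add])
    hθ1 (rateIneq_centred hr hθ0.le hθ1) (fun k g hg => (hS k g hg).1) (fun k g hg => (hS k g hg).2)
    (fun _ _ _ => by rw [norm_zero])

/-! ## §T Sanity arithmetic (pure numbers; the refuter's table-H letters are a READING of [II] p. 21, asserted nowhere) -/

/-- At `r = 1`, `θ = 15∕26` (`= ω̂ + τ̄(2B + p̄₀)` with `ω̂ = 1∕13`), `z = p̄₀∕B = 2`: `c̄ = τ̄p̄₀ = 1∕4`, `r₄ = ω̂ + 2Bτ̄ = 17∕52`,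
`c̄ + r₄ = 15∕26`; the rate `μ = 44∕125 = 0.352` is ADMISSIBLE (PRICING-NE9 v10 (E10-2): grid supremum `0.3518` at
`ρ* ≈ 0.032`, centre value `272∕780 ≈ 0.3487`). -/
example : ∀ ρ ∈ Icc (0 : ℝ) (17 / 52),
    ((17 / 52 : ℝ) ^ 2 - ρ ^ 2) * 1 ≤ 44 / 125 * (17 / 52) * (1 ^ 2 - (1 / 4 + ρ) ^ 2) := by
  intro ρ hρ
  nlinarith [sq_nonneg (ρ - 13 / 400), hρ.1, hρ.2]

/-- … versus the centred rate of `NE9PolydiscChain` at the same letters, `θ = 15∕26 ≈ 0.577`: `44∕125 < 15∕26`, and the crude closed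
form of §7 gives `(17∕52)∕(1 − (15∕26)²) = 221∕451 ≈ 0.490`, also below `θ`. -/
example : (44 : ℝ) / 125 < 15 / 26 ∧ (17 : ℝ) / 52 * 1 / (1 ^ 2 - (1 / 4 + 17 / 52) ^ 2) = 221 / 451 ∧
    (221 : ℝ) / 451 < 15 / 26 := by norm_num

/-- `c̄ + r₄ = θ·r` at those letters. -/
example : (1 : ℝ) / 4 + 17 / 52 = 15 / 26 * 1 := by norm_num

end Summit.QuantumFields.BalabanUV.T4Continuum.NE9PolydiscChainOffCentre

end
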